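import Mathlib
import Literature.MathematicalPhysics.QuantumFieldTheory.Balaban1983to89.B1Eq333Decomposition
import Literature.MathematicalPhysics.QuantumFieldTheory.Balaban1983to89.B2Sect2BDensities

/-!
# `Balaban1983to89.B2IndStep2115` — T. Bałaban, *(Higgs)₂,₃ quantum fields in a finite volume. II. An upper bound*,
Commun. Math. Phys. **86** (1982) 555–594 [Balaban1982Higgs2], Sect. 2.C–2.D pp. 580–582: the translation (2.110),
the replacement (2.111) → (2.112), the external field «B̃» of p. 582, the INDUCTIVE STEP *"the inequality (2.43) but
with k + 1 instead of k"* (p. 582, what (2.115) delivers), the induction on k closing (2.43), and the FINAL ASSEMBLY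
of Sect. 2.D ((2.43) at k = K with (2.116), (2.117), (2.118) ⇒ Z^ε ≤ exp(E₊|T_ε|), the upper half of the Theorem) —
schematic statements with the analytic inputs displayed as hypotheses, kernel algebra PROVED

statement-level skeleton of published theorems with citation tags; proofs where landed; nothing here is a claim about the Yang–Mills mass gap

PDF held: `paper:balaban1982-cmp86-higgs23-ii` (journal page = PDF page + 554); pp. 580–582 READ AS IMAGES on the ×2
renders `run/shared/lean/pub/pub-balaban/b2b-balaban-ref1/pages/1982-cmp86-higgs23-II/1982-cmp86-higgs23-II-p026-x2.png`
… `-p028-x2.png`.  Unit `lit-balaban-r14` gen 4 (reader/typer of B1–B2; B2 fold owner = r02), HOME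
`run/shared/lean/pub/lit-balaban/`.

SKELETON rows served.  **B2.Eq2.115** ((2.110)–(2.112), (2.115) pp. 580–582; before: `absent (the inductive step as
a statement = B2.Eq2.43 at k+1)`): (2.110) `transl2110` (= part I (3.10) `B1Sect3Statements.transl310` BY NAME),
(2.111) → (2.112) `eq2112_exact`/`eq2112_of_replacement`, p. 582 «B̃» `bTilde582` (= `B2Sect2BDensities.aTilde245` at
the next scale), the step `IndStep2115` over the run carrier `B2StepK.Run243` with ONE constant; the display (2.115)
itself (p. 581, a page-long conditional-integral inequality) is NOT typed.  **B2.Eq2.43** ((2.43) p. 566, typed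
`B2Sect2Statements.Ineq243Printed` (r02, of record) / `B2StepK.IndHyp243` (r14)): the induction on k closing it from the
first step and the inductive steps, `indHyp243_of_step`.  **B2.Thm@556 / B2.Eq2.116 / B2.Eq2.117**: the Sect. 2.D
assembly `upper_of_final` / `upperBoundWith_of_final` (landing in part I's `B1LowerBound.UpperBoundWith`, the upper
half of Theorem (1.14) = Theorem (1.3) of part II; bridge of record to `B2Sect2Statements.MainThmPrinted`:
`B2Thm13Bridge`, p39).

THE SOURCE TEXT, verbatim.  p. 580 [PDF 26]: *"Now we make a translation of the form
φ = φ′ + aL⁻²C^{(k)}_{Λ₄^{(k)}}(B^k(Λ₂^{(k)}), B^{(k+1),η})Q*(B^{(k+1),η})ψ.  (2.110)  This translation changes the first and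
the fourth terms on the right side of (2.108) in an obvious way. (…) If the configuration appears in the expression
(a_kG_k(B^k(Λ₂^{(k)}), B^{(k+1),η})Q_k^*(B^{(k+1),η})Λ₆^{(k)}aL⁻²·C^{(k)}_{Λ₄^{(k)}}(B^k(Λ₂^{(k)}), B^{(k+1),η})Q*(B^{(k+1),η})ψ)(x),
(2.111)  then x ∈ B^k(Λ₇^{(k)}), and we replace C^{(k)}_{Λ₄^{(k)}} by C^{(k)}, Λ₆^{(k)} by 1, and using the recursive
equation (I.2.41) we get  (2.111) = (a_{k+1}L⁻²G^η_{k+1}(B^k(Λ₂^{(k)}), B^{(k+1),η})Q*_{k+1}(B^{(k+1),η})Λ₆^{(k)′}ψ)(x)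
+ O((L^kε)^κ).  (2.112)"*  p. 581 [PDF 27]: *"After all these transformations, the conditional integration with
respect to A′, φ′ with the conditioning on Λ₅^{(k)c}, and the translations inverse to (2.80), (2.110), we get the
inequality  [the integral (2.53)] ≤ Σ_{Λ₀^{(0)},…,Λ₀^{(k−1)},Λ₀^{(k)}} ∫dA∫dφ χ_{k+1}ζ_{Λ₀^{(k)}}χ_{Λ₋₁^{(k)}∩Λ₅^{(k)c}}
χ_{k,Λ₅^{(k)c}}·ρ′^{(k)}(…)·exp[…]·∫dμ(A′)∫dμ(φ′)χ(A′)χ(φ′)exp(V^{(k)}(…))·exp(O((L^kε)^{κ₀})|Λ₇^{(k−1)′}∩Λ₇^{(k)c}| +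
O((L^kε)^κ)|T₁^{(k)}|),  (2.115)"*  p. 582 [PDF 28]: *"where  B̃ = (1 − θ_{k+1})θ_kA^{(k)} + θ_{k+1}B^{(k+1),η}. (…)
The last operation is a rescaling of the obtained expressions from the L-lattice to L^{k+1}ε-lattice. Gathering
together all the estimates, we get the inequality (2.43) but with k + 1 instead of k.  D. The Final Step.  The
procedure is continued until k = K, where K is such that L^Kε ≤ ε₀, L^{K+1}ε > ε₀. Then we estimate
𝒫^{(K),L^Kε}(Λ₇^{(K−1)}, B^{(K),ε}, ψ) ≤ O((L^Kε)^{κ₀})|Λ₇^{(K)}|.  (2.116)  Now it is sufficient to prove the estimate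
∫dB∫dψ Σ ρ^{(K),L^Kε}(…)exp(−E₀)·exp(O(1)ε^{κ₀}|Λ₇^{(0)c}| + Σ_{j=1}^{K−1}O(1)(L^jε)^{κ₀}|Λ₇^{(j−1)′}∩Λ₇^{(j)c}| +
O(1)(L^{K−1}ε)^{κ₀}|Λ₇^{(K−1)}|) ≤ exp(O(1)|T_ε|),  (2.117)  with the constant O(1) independent of ε, because for the last
sum in the exponent on the right side of (2.43), we have  Σ_{j=0}^{K−1}O((L^jε)^κ)|T₁^{(j)}| = Σ_{j=0}^{K−1}O(1)(L^jε)^{κ₀}|T_ε|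
≤ O(1)|T_ε|.  (2.118)  The inequality (2.117) will be proved in the next chapter."*

DICTIONARY.  (2.110): schematic field components `P` (φ on the fine lattice), `P'` (ψ on the block lattice), `c` ↤
aL⁻², `CΛ4 : Matrix P P ℝ` ↤ C^{(k)}_{Λ₄^{(k)}}(B^k(Λ₂^{(k)}), B^{(k+1),η}), `Qs : Matrix P P' ℝ` ↤ Q*(B^{(k+1),η}).
(2.111)–(2.112): the operator data of ONE renormalization step = part I's `B1RG242.StepData S` (`S.Gk` ↤ G_k, `S.Qks`
↤ Q_k^*, `S.Ck` ↤ C^{(k)}, `S.Qs` ↤ Q*, `S.α` ↤ a_k, `S.β` ↤ aL⁻² on the unit lattice, `S.γ = αβ/(α + β)` ↤ a_{k+1}L⁻² by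
(I.2.13), `S.Gk1`, `S.Qk1s` ↤ G_{k+1}, Q*_{k+1}), `v` ↤ Λ₆^{(k)′}ψ, `lhs` ↤ the number (2.111) at the point x.  p. 582
«B̃»: `θ : ℕ → X → ℝ`, `A : ℕ → X → M` as in `B2Sect2BDensities.aTilde251` (`A (k+1)` ↤ B^{(k+1),η}).  The step: the
run carrier `B2StepK.Run243` (fields ε, L, K, d, κ₀, κ, Z, `rhs k c c′` ↤ the right side of (2.43) after k steps with
O-coefficient families c, c′), `C` ↤ ONE bound for all the O(1)'s (uniform in k, ε).  Final step: reals `Z` ↤ Z^ε,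
`I` ↤ the bracket Σ∫ρ^{(K)}exp(𝒫^{(K)} − E₀ + Σ…) of (2.43) at k = K, `s` ↤ the last exponent Σ_{j<K}O((L^jε)^κ)|T₁^{(j)}|,
`lhs` ↤ the left side of (2.117), `vol` ↤ |T_ε|, `C₁`, `C₂` ↤ the O(1)'s of (2.117), (2.118).

WHAT IS PROVED (kernel, axioms standard) and what is HYPOTHESIS.  `transl2110_eq_transl310` (definitional);
`eq2112_exact` — the exact part of (2.112) IS part I's recursive equation (I.2.41) in p14's operator form
`B1Eq333Decomposition.eq342_op` (a_kaL⁻²·G_kQ_k^*C^{(k)}Q* = a_{k+1}L⁻²·G_{k+1}Q*_{k+1}), applied to Λ₆′ψ; the printed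
O((L^kε)^κ) is the cost of the two replacements C^{(k)}_{Λ₄} ↦ C^{(k)}, Λ₆^{(k)} ↦ 1 (Proposition I.2.3-type locality),
displayed as the hypothesis of `eq2112_of_replacement`; `bTilde582_eq_aTilde245` (B̃ is the «Ã» of (2.45) one scale
up, definitional) and `bTilde582_eq_aTilde251` (= the whole field (2.51) with k + 1 steps where θ_k = 1, by
`B2Sect2BDensities.aTilde251_eq_aTilde245`); `indHyp243_of_step` (the induction on k: (2.43) at k = 0 for every run +
the step k → k + 1 for k < K with the same constant ⇒ `B2StepK.IndHyp243`), `holds243At_of_indHyp243` (converse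
bookkeeping); `integral_exp_mono` (inserting (2.116) under the integral: ρ ≥ 0 and 𝒫 ≤ b pointwise give ∫ρe^{𝒫+r} ≤
∫ρe^{b+r}), `upper_of_final` and `upperBoundWith_of_final`/`upperBoundPrinted_of_final` (Z ≤ I·e^s, I ≤ lhs,
lhs ≤ e^{C₁|T_ε|}, s ≤ C₂|T_ε| ⇒ Z ≤ e^{(C₁+C₂)|T_ε|}, uniformly over a cutoff family ⇒ `B1LowerBound.UpperBoundWith`).
NOT PROVED HERE: (2.115) itself, (2.116), (2.117) (= Sect. 3, `B2StepK.Ineq2117Printed`/`B2Sect2Statements.Claim2117Printed`),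
the analytic O-terms.
-/

open scoped BigOperators Matrix
open Finset

namespace Literature.MathematicalPhysics.QuantumFieldTheory.Balaban1983to89.B2IndStep2115

/-! ## §1 (2.110) p. 580: the translation in φ -/

section Eq2110

variable {P P' : Type*} [Fintype P] [Fintype P']

/-- **(2.110)** p. 580 [PDF 26], verbatim: *"φ = φ′ + aL⁻²C^{(k)}_{Λ₄^{(k)}}(B^k(Λ₂^{(k)}), B^{(k+1),η})Q*(B^{(k+1),η})ψ"* — the
translated scalar field as a function of the new variable φ′ and the block field ψ (`c` ↤ aL⁻², `CΛ4` ↤ the covariance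
with Dirichlet conditions outside Λ₄^{(k)} in the background, `Qs` ↤ Q*(B^{(k+1),η})). [cite: Balaban1982Higgs2, (2.110) p.580] -/
def transl2110 (c : ℝ) (CΛ4 : Matrix P P ℝ) (Qs : Matrix P P' ℝ) (φ' : P → ℝ) (ψ : P' → ℝ) : P → ℝ :=
  φ' + c • (CΛ4 *ᵥ (Qs *ᵥ ψ))

/-- (2.110) IS the part I translation (I.3.10) `B1Sect3Statements.transl310` (as (2.18) and (2.23) are — *"analogous
to the translation (I.3.10)"*, p. 560) with C^{(k)}_{Λ₄^{(k)}}(…) and Q*(B^{(k+1),η}) as the two operators. KERNEL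
(definitional). [cite: Balaban1982Higgs2, (2.110) p.580] -/
theorem transl2110_eq_transl310 (c : ℝ) (CΛ4 : Matrix P P ℝ) (Qs : Matrix P P' ℝ) (φ' : P → ℝ) (ψ : P' → ℝ) :
    transl2110 c CΛ4 Qs φ' ψ = B1Sect3Statements.transl310 c CΛ4.mulVecLin Qs.mulVecLin φ' ψ := by
  simp [transl2110, B1Sect3Statements.transl310]

/-- (2.110) at a point: `φ(x) = φ′(x) + aL⁻² Σ_{x′} C(x,x′) Σ_y Q*(x′,y)ψ(y)`. [cite: Balaban1982Higgs2, (2.110) p.580] -/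
theorem transl2110_apply (c : ℝ) (CΛ4 : Matrix P P ℝ) (Qs : Matrix P P' ℝ) (φ' : P → ℝ) (ψ : P' → ℝ) (x : P) :
    transl2110 c CΛ4 Qs φ' ψ x = φ' x + c * (CΛ4 *ᵥ (Qs *ᵥ ψ)) x := rfl

/-- The translation is undone by subtracting the same configuration (*"the translations inverse to (2.80), (2.110)"*,
p. 581). KERNEL. [cite: Balaban1982Higgs2, (2.110) p.580] -/
theorem transl2110_sub (c : ℝ) (CΛ4 : Matrix P P ℝ) (Qs : Matrix P P' ℝ) (φ' : P → ℝ) (ψ : P' → ℝ) :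
    transl2110 c CΛ4 Qs φ' ψ - c • (CΛ4 *ᵥ (Qs *ᵥ ψ)) = φ' := by
  simp [transl2110]

end Eq2110

/-! ## §2 (2.111) → (2.112) p. 580: the recursive equation (I.2.41) behind the replacement -/

section Eq2112

variable {ι κ ν : Type*} [Fintype ι] [Fintype κ] [Fintype ν] [DecidableEq ι] [DecidableEq κ] [DecidableEq ν]
variable (S : B1RG242.StepData ℝ ι κ ν)

/-- **the exact part of (2.112)** p. 580: after the replacements C^{(k)}_{Λ₄^{(k)}} ↦ C^{(k)} and Λ₆^{(k)} ↦ 1, the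
configuration (2.111) is `(a_kG_kQ_k^*·aL⁻²C^{(k)}Q*)(Λ₆^{(k)′}ψ)` and *"using the recursive equation (I.2.41) we get"*
`(a_{k+1}L⁻²G_{k+1}Q*_{k+1}Λ₆^{(k)′}ψ)(x)` — EXACTLY, at every x, for every block field `v` ↤ Λ₆^{(k)′}ψ: this is part
I's (2.41) in the operator form `B1Eq333Decomposition.eq342_op` (a_kaL⁻²·G_kQ_k^*C^{(k)}Q* = a_{k+1}L⁻²·G_{k+1}Q*_{k+1},
a_{k+1}L⁻² = `S.γ` by (I.2.13) `B1RG242.StepData.γ_printed`), under QQ* = 1 and the invertibility of the arguments of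
G_k and C^{(k)}. KERNEL. [cite: Balaban1982Higgs2, (2.112) p.580] -/
theorem eq2112_exact (hQ : S.Q * S.Qs = 1) (hαβ : S.α + S.β ≠ 0) (hG : IsUnit (S.H + S.α • S.Pk))
    (hC : IsUnit (S.β • S.P + S.Δk)) (v : ν → ℝ) (x : ι) :
    (((S.α * S.β) • (S.Gk * S.Qks * S.Ck * S.Qs)) *ᵥ v) x = ((S.γ • (S.Gk1 * S.Qk1s)) *ᵥ v) x := by
  rw [B1Eq333Decomposition.eq342_op S hQ hαβ hG hC]

/-- **(2.112)** p. 580 with its printed error: if the two replacements (C^{(k)}_{Λ₄^{(k)}} ↦ C^{(k)}, Λ₆^{(k)} ↦ 1 — their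
cost is the analytic input, Proposition I.2.3-type locality for x ∈ B^k(Λ₇^{(k)}), HYPOTHESIS `hrepl`) move the number
(2.111) `lhs` by at most `e` ↤ O((L^kε)^κ), then `|(2.111) − (a_{k+1}L⁻²G_{k+1}Q*_{k+1}Λ₆′ψ)(x)| ≤ e`. KERNEL.
[cite: Balaban1982Higgs2, (2.112) p.580] -/
theorem eq2112_of_replacement (hQ : S.Q * S.Qs = 1) (hαβ : S.α + S.β ≠ 0) (hG : IsUnit (S.H + S.α • S.Pk))
    (hC : IsUnit (S.β • S.P + S.Δk)) (v : ν → ℝ) (x : ι) {lhs e : ℝ}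
    (hrepl : |lhs - (((S.α * S.β) • (S.Gk * S.Qks * S.Ck * S.Qs)) *ᵥ v) x| ≤ e) :
    |lhs - ((S.γ • (S.Gk1 * S.Qk1s)) *ᵥ v) x| ≤ e := by
  rwa [← eq2112_exact S hQ hαβ hG hC v x]

end Eq2112

/-! ## §3 p. 582: the external field «B̃ = (1 − θ_{k+1})θ_kA^{(k)} + θ_{k+1}B^{(k+1),η}» -/

section BTilde

variable {X M : Type*} [AddCommGroup M] [Module ℝ M]

/-- **p. 582 [PDF 28]**, verbatim: *"where B̃ = (1 − θ_{k+1})θ_kA^{(k)} + θ_{k+1}B^{(k+1),η}"* — the external vector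
field of the (k+1)-st step in its scalar-field part (`θ (k+1)`, `θ k` ↤ θ_{k+1}, θ_k; `A k` ↤ A^{(k)}, `A (k+1)` ↤
B^{(k+1),η}, the next cut-off background (2.44)/(2.54)). [cite: Balaban1982Higgs2, (2.115) p.582] -/
def bTilde582 (θ : ℕ → X → ℝ) (A : ℕ → X → M) (k : ℕ) : X → M :=
  fun x => ((1 - θ (k + 1) x) * θ k x) • A k x + θ (k + 1) x • A (k + 1) x

/-- B̃ is the «Ã = (1 − θ_k)θ_{k−1}A^{(k−1),ε} + θ_kA^{(k),ε}» of (2.45) p. 567 ONE SCALE UP (k ↦ k + 1) — definitionally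
`B2Sect2BDensities.aTilde245`. KERNEL. [cite: Balaban1982Higgs2, (2.115) p.582] -/
theorem bTilde582_eq_aTilde245 (θ : ℕ → X → ℝ) (A : ℕ → X → M) (k : ℕ) :
    bTilde582 θ A k = B2Sect2BDensities.aTilde245 (θ (k + 1)) (θ k) (A k) (A (k + 1)) := rfl

/-- Where θ_k = 1 (on B^{k−1}(Λ₂^{(k−1)}), p. 567) and under the nesting of the cut-offs, B̃ IS the whole external field
(2.51) p. 569 after k + 1 steps (k ≥ 1): the (2.51)-coefficients of A₀, A^{(1)}, …, A^{(k−1)} vanish there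
(`B2Sect2BDensities.aTilde251_eq_aTilde245`). KERNEL. [cite: Balaban1982Higgs2, (2.115) p.582] -/
theorem bTilde582_eq_aTilde251 {θ : ℕ → X → ℝ} (hθ : B2Sect2BDensities.Nested θ) (A₀ : X → M) (A : ℕ → X → M)
    (m : ℕ) {x : X} (hx : θ (m + 1) x = 1) :
    bTilde582 θ A (m + 1) x = B2Sect2BDensities.aTilde251 θ A₀ A (m + 2) x := by
  rw [B2Sect2BDensities.aTilde251_eq_aTilde245 hθ A₀ A m hx]
  rfl

end BTilde

/-! ## §4 p. 582: «the inequality (2.43) but with k + 1 instead of k» — the inductive step and the induction -/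

section Step

/-- (2.43) p. 566 at ONE level k for ONE run with the constant `C`: there are O-coefficient families c, c′ bounded by
C with Z^ε ≤ rhs_k(c, c′) — the k-th instance inside `B2StepK.IndHyp243` (same shape, so that the induction below lands
in that statement). [cite: Balaban1982Higgs2, (2.43) p.566] -/
def Holds243At (R : B2StepK.Run243) (C : ℝ) (k : ℕ) : Prop :=
  ∃ c c' : ℕ → ℝ, (∀ i, |c i| ≤ C) ∧ (∀ i, |c' i| ≤ C) ∧ R.Z ≤ R.rhs k c c'

/-- **the inductive step** p. 582 [PDF 28], verbatim: *"Gathering together all the estimates, we get the inequality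
(2.43) but with k + 1 instead of k"* (the content of Sect. 2.C, delivered by (2.115)) — TYPED for one run and one k
with the SAME constant C on both sides (the O(1)'s of the construction do not depend on k or ε).
[cite: Balaban1982Higgs2, (2.115) p.582] -/
def IndStep2115 (R : B2StepK.Run243) (C : ℝ) (k : ℕ) : Prop :=
  Holds243At R C k → Holds243At R C (k + 1)

/-- **the induction on k closing (2.43)**: if for ONE constant C every run satisfies (2.43) at k = 0 (the starting
integral; the first genuine instance (2.33) p. 564 is k = 1) and the step k → k + 1 for every k < K, then (2.43) holds
after every k ≤ K steps uniformly — `B2StepK.IndHyp243`. KERNEL (induction on k). [cite: Balaban1982Higgs2, (2.43) p.566] -/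
theorem indHyp243_of_step {J : Type} (fam : J → B2StepK.Run243) {C : ℝ}
    (hκ : ∀ j, 0 < (fam j).kappa0 ∧ ((fam j).d : ℝ) < (fam j).kappa)
    (hbase : ∀ j, Holds243At (fam j) C 0)
    (hstep : ∀ j k, k < (fam j).K → IndStep2115 (fam j) C k) :
    B2StepK.IndHyp243 fam := by
  refine ⟨C, fun j => ⟨(hκ j).1, (hκ j).2, fun k hk => ?_⟩⟩
  induction k with
  | zero => exact hbase j
  | succ k ih => exact hstep j k (Nat.lt_of_succ_le hk) (ih (Nat.le_of_succ_le hk))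

/-- Conversely (bookkeeping): (2.43) uniformly in k ≤ K gives each level with the same constant. KERNEL.
[cite: Balaban1982Higgs2, (2.43) p.566] -/
theorem holds243At_of_indHyp243 {J : Type} {fam : J → B2StepK.Run243} (h : B2StepK.IndHyp243 fam) :
    ∃ C : ℝ, ∀ j k, k ≤ (fam j).K → Holds243At (fam j) C k := by
  obtain ⟨C, hC⟩ := h
  exact ⟨C, fun j k hk => (hC j).2.2 k hk⟩

/-- (2.43) at one level is monotone in the constant (a larger uniform bound for the O-coefficients is still a bound).
KERNEL. [cite: Balaban1982Higgs2, (2.43) p.566] -/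
theorem Holds243At.mono {R : B2StepK.Run243} {C C' : ℝ} {k : ℕ} (h : Holds243At R C k) (hC : C ≤ C') :
    Holds243At R C' k := by
  obtain ⟨c, c', hc, hc', hZ⟩ := h
  exact ⟨c, c', fun i => (hc i).trans hC, fun i => (hc' i).trans hC, hZ⟩

/-- The step at the last level K reached by a run: the levels k ≤ K are all that (2.43) asserts; the final step k = K
is treated separately in Sect. 2.D ((2.116)–(2.118), below). KERNEL (the same induction, read at k = K with the constant kept).
[cite: Balaban1982Higgs2, (2.116) p.582] -/
theorem holds243At_last {J : Type} (fam : J → B2StepK.Run243) {C : ℝ}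
    (hbase : ∀ j, Holds243At (fam j) C 0) (hstep : ∀ j k, k < (fam j).K → IndStep2115 (fam j) C k) (j : J) :
    Holds243At (fam j) C (fam j).K := by
  have : ∀ k, k ≤ (fam j).K → Holds243At (fam j) C k := by
    intro k hk
    induction k with
    | zero => exact hbase j
    | succ k ih => exact hstep j k (Nat.lt_of_succ_le hk) (ih (Nat.le_of_succ_le hk))
  exact this _ le_rfl

end Step

/-! ## §5 Sect. 2.D p. 582: the final assembly (2.43)_K + (2.116) + (2.117) + (2.118) ⇒ Z^ε ≤ exp(E₊|T_ε|) -/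

section Final

open MeasureTheory

/-- **inserting (2.116) under the integral** (p. 582, *"Then we estimate 𝒫^{(K),L^Kε}(…) ≤ O((L^Kε)^{κ₀})|Λ₇^{(K)}|"*):
for a non-negative density ρ and exponents 𝒫 ≤ b pointwise, ∫ρ·exp(𝒫 + r) ≤ ∫ρ·exp(b + r) (the larger side
integrable). This is how (2.116) turns the bracket of (2.43) at k = K into the left side of (2.117). KERNEL
(`integral_mono_of_nonneg`). [cite: Balaban1982Higgs2, (2.116) p.582] -/
theorem integral_exp_mono {Ω : Type*} [MeasurableSpace Ω] (μ : Measure Ω) {ρ calP b r : Ω → ℝ}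
    (hρ : ∀ ω, 0 ≤ ρ ω) (hP : ∀ ω, calP ω ≤ b ω)
    (hint : Integrable (fun ω => ρ ω * Real.exp (b ω + r ω)) μ) :
    ∫ ω, ρ ω * Real.exp (calP ω + r ω) ∂μ ≤ ∫ ω, ρ ω * Real.exp (b ω + r ω) ∂μ := by
  refine integral_mono_of_nonneg (Filter.Eventually.of_forall fun ω => ?_) hint
    (Filter.Eventually.of_forall fun ω => ?_)
  · exact mul_nonneg (hρ ω) (Real.exp_pos _).le
  · exact mul_le_mul_of_nonneg_left (Real.exp_le_exp.2 (by linarith [hP ω])) (hρ ω)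

/-- **the final assembly of Sect. 2.D** p. 582, in the reals of ONE cutoff: (2.43) at k = K reads `Z ≤ I·exp(s)`
(`I` ↤ the bracket Σ∫ρ^{(K)}exp(𝒫^{(K)} − E₀ + Σ_j O((L^jε)^{κ₀})|…|), `s` ↤ Σ_{j<K}O((L^jε)^κ)|T₁^{(j)}|); (2.116) inserted
under the integral gives `I ≤ lhs` (`lhs` ↤ the left side of (2.117)); (2.117) is `lhs ≤ exp(C₁|T_ε|)`; (2.118) is
`s ≤ C₂|T_ε|`. Hence `Z ≤ exp((C₁ + C₂)|T_ε|)` — *"Now it is sufficient to prove the estimate (2.117) … because for the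
last sum in the exponent on the right side of (2.43), we have (2.118)"*. KERNEL. [cite: Balaban1982Higgs2, (2.117) p.582] -/
theorem upper_of_final {Z I s lhs C₁ C₂ vol : ℝ} (h243 : Z ≤ I * Real.exp s) (h2116 : I ≤ lhs)
    (h2117 : lhs ≤ Real.exp (C₁ * vol)) (h2118 : s ≤ C₂ * vol) :
    Z ≤ Real.exp ((C₁ + C₂) * vol) := by
  calc Z ≤ I * Real.exp s := h243
    _ ≤ lhs * Real.exp s := mul_le_mul_of_nonneg_right h2116 (Real.exp_pos _).le
    _ ≤ Real.exp (C₁ * vol) * Real.exp s := mul_le_mul_of_nonneg_right h2117 (Real.exp_pos _).le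
    _ ≤ Real.exp (C₁ * vol) * Real.exp (C₂ * vol) :=
        mul_le_mul_of_nonneg_left (Real.exp_le_exp.2 h2118) (Real.exp_pos _).le
    _ = Real.exp ((C₁ + C₂) * vol) := by rw [← Real.exp_add]; ring_nf

/-- **the upper half of the Theorem from Sect. 2.D**, uniformly over a family of cutoffs `F` (part I's carrier
`B1LowerBound.CutoffFamily`: ε, |T_ε|, Z^ε per instance): if for every instance (2.43) at its last level, (2.116),
(2.117) and (2.118) hold with constants C₁, C₂ INDEPENDENT OF ε, then `Z^ε ≤ exp((C₁ + C₂)|T_ε|)` for all ε —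
`B1LowerBound.UpperBoundWith F (C₁ + C₂)` (Theorem (1.3) p. 556 = part I Theorem (1.14), upper inequality; bridge to
`B2Sect2Statements.MainThmPrinted`: `B2Thm13Bridge`). KERNEL. [cite: Balaban1982Higgs2, Theorem (1.3) p.556] -/
theorem upperBoundWith_of_final {I : Type} (F : B1LowerBound.CutoffFamily I) (bracket s lhs : I → ℝ) {C₁ C₂ : ℝ}
    (h243 : ∀ i, F.Z i ≤ bracket i * Real.exp (s i)) (h2116 : ∀ i, bracket i ≤ lhs i)
    (h2117 : ∀ i, lhs i ≤ Real.exp (C₁ * F.vol i)) (h2118 : ∀ i, s i ≤ C₂ * F.vol i) :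
    B1LowerBound.UpperBoundWith F (C₁ + C₂) :=
  fun i => upper_of_final (h243 i) (h2116 i) (h2117 i) (h2118 i)

/-- … hence *"there exist the constant E₊ independent of ε, T_ε"*: `B1LowerBound.UpperBoundPrinted F`. KERNEL.
[cite: Balaban1982Higgs2, Theorem (1.3) p.556] -/
theorem upperBoundPrinted_of_final {I : Type} (F : B1LowerBound.CutoffFamily I) (bracket s lhs : I → ℝ) {C₁ C₂ : ℝ}
    (h243 : ∀ i, F.Z i ≤ bracket i * Real.exp (s i)) (h2116 : ∀ i, bracket i ≤ lhs i)
    (h2117 : ∀ i, lhs i ≤ Real.exp (C₁ * F.vol i)) (h2118 : ∀ i, s i ≤ C₂ * F.vol i) :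
    B1LowerBound.UpperBoundPrinted F :=
  ⟨C₁ + C₂, upperBoundWith_of_final F bracket s lhs h243 h2116 h2117 h2118⟩

/-- The (2.118) input in the printed currency is `B2StepK.display2118` / `B2Sect2Statements.sum2118_geometric`
(geometric series in (L^jε)^{κ₀}); here its abstract consequence: a sum of K terms each ≤ C·(L^jε)^{κ₀}·|T_ε| with
Σ_j (L^jε)^{κ₀} ≤ S gives `s ≤ (C·S)·|T_ε|`. KERNEL. [cite: Balaban1982Higgs2, (2.118) p.582] -/
theorem sum2118_le {K : ℕ} {C S vol : ℝ} (ℓ : ℕ → ℝ) (κ₀ : ℝ) (x : ℕ → ℝ) (hC : 0 ≤ C) (hvol : 0 ≤ vol)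
    (hx : ∀ j, j < K → x j ≤ C * ℓ j ^ κ₀ * vol) (hS : ∑ j ∈ Finset.range K, ℓ j ^ κ₀ ≤ S) :
    ∑ j ∈ Finset.range K, x j ≤ C * S * vol := by
  calc ∑ j ∈ Finset.range K, x j ≤ ∑ j ∈ Finset.range K, C * ℓ j ^ κ₀ * vol :=
        Finset.sum_le_sum fun j hj => hx j (Finset.mem_range.1 hj)
    _ = C * (∑ j ∈ Finset.range K, ℓ j ^ κ₀) * vol := by rw [Finset.mul_sum, Finset.sum_mul]
    _ ≤ C * S * vol := by gcongr

end Final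

end Literature.MathematicalPhysics.QuantumFieldTheory.Balaban1983to89.B2IndStep2115
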